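import Mathlib

/-!
# The triangular (certified-rank) count for identity tests in a bi-invariant test space
(negative lemma for the crux `SubgroupIdentityDesigns`, stmt-MatrixMultiplication-14079; the common
generalisation of the graded Neumann count, the walls, and the stabilizer / normalizer / permutability
counts of `StabilizerCount.lean` and `GradedNormalizerCount.lean`)

`G` finite, `J ≤ ℂ^G` BI-INVARIANT, `S ⊆ G` a set, `f ∈ J` an identity test on `S` (`f 1 = 1`, `f = 0` on
`S ∖ {1}`).  A sequence `s₀, …, s_{n−1}` of distinct points of `G` is CERTIFIED by pairs `(uᵢ, vᵢ)` if
`uᵢ sᵢ vᵢ = 1` and `uᵢ sⱼ vᵢ ∈ S` for all `j < i`.  Then the probes `g ↦ f (uᵢ g vᵢ) ∈ J` have a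
unitriangular value matrix on the points (`1` on the diagonal, CERTIFIED `0` below it, unknown above),
so the evaluations at the `sᵢ` are linearly independent on `J`:

* `card_le_finrank_of_triangular` — **`n ≤ dim J`.**

Special cases: isolable points (`uᵢ S vᵢ ⊆ S`, any order: `StabilizerCount`), the graded Neumann count
(first the points `a b`, `b ≠ 1`, probed by `(a⁻¹, b⁻¹)` which keep `H₁H₂` inside `S = H₁H₂H₃`, then the
isolable points `a c`), and every mixture; the CERTIFIED RANK of `S` (the longest certified sequence) is
a purely combinatorial lower bound for `dim J`, hence a linear-algebra-free necessary test for candidate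
designs at level `k` (`certified rank ≤ dim F_k ≤ N_k`).  Sorry-free; standard axioms.
-/

set_option linter.dupNamespace false

noncomputable section

open scoped BigOperators Classical
open Module

namespace Summit.MatrixMultiplication.MatrixMultiplication.Theorems.SubgroupIdentityDesigns.Negative

variable {G : Type} [Group G] [Finite G]

/-- **TRIANGULAR COUNT.**  If `s : Fin n → G` is injective and certified by `(u, v)` — `uᵢ sᵢ vᵢ = 1`
and `uᵢ sⱼ vᵢ ∈ S` for `j < i` — then `n ≤ dim J` for every bi-invariant `J` carrying an identity test
on `S` (the points `sᵢ` themselves need not lie in `S`). -/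
theorem card_le_finrank_of_triangular (J : Submodule ℂ (G → ℂ))
    (hJ : ∀ f ∈ J, ∀ a b : G, (fun g : G => f (a * g * b)) ∈ J)
    (S : Set G) {f : G → ℂ} (hf : f ∈ J) (h1 : f 1 = 1) (h0 : ∀ s ∈ S, s ≠ 1 → f s = 0)
    {n : ℕ} (s u v : Fin n → G) (hinj : Function.Injective s)
    (hdiag : ∀ i, u i * s i * v i = 1) (hlow : ∀ i j, j < i → u i * s j * v i ∈ S) :
    n ≤ Module.finrank ℂ J := by
  classical
  haveI : Fintype G := Fintype.ofFinite G
  let w : Fin n → J := fun i => ⟨fun g => f (u i * g * v i), hJ f hf _ _⟩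
  -- the value matrix is unitriangular: `1` on the diagonal, `0` below
  have hM1 : ∀ i, (w i : G → ℂ) (s i) = 1 := fun i => by
    show f (u i * s i * v i) = 1
    rw [hdiag, h1]
  have hM0 : ∀ i j, j < i → (w i : G → ℂ) (s j) = 0 := by
    intro i j hji
    show f (u i * s j * v i) = 0
    refine h0 _ (hlow i j hji) fun h => (ne_of_gt hji) (hinj ?_)
    -- `uᵢ sⱼ vᵢ = 1 = uᵢ sᵢ vᵢ` forces `sⱼ = sᵢ`
    have e : u i * s j * v i = u i * s i * v i := by rw [h, hdiag]
    have e' : s j = s i := by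
      calc s j = (u i)⁻¹ * (u i * s j * v i) * (v i)⁻¹ := by group
        _ = (u i)⁻¹ * (u i * s i * v i) * (v i)⁻¹ := by rw [e]
        _ = s i := by group
    exact e'.symm
  -- linear independence by forward substitution
  have hli : LinearIndependent ℂ w := by
    rw [Fintype.linearIndependent_iff]
    intro c hc
    have hev : ∀ j, ∑ i, c i * (w i : G → ℂ) (s j) = 0 := fun j => by
      have := congrArg (fun φ : J => (φ : G → ℂ) (s j)) hc
      simpa [Submodule.coe_sum, Finset.sum_apply] using this
    -- strong induction on the index
    suffices h : ∀ m : ℕ, ∀ j : Fin n, (j : ℕ) = m → c j = 0 from fun j => h j j rfl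
    intro m
    induction m using Nat.strong_induction_on with
    | _ m ih =>
      intro j hj
      have key : ∑ i, c i * (w i : G → ℂ) (s j) = c j := by
        rw [Finset.sum_eq_single j]
        · rw [hM1, mul_one]
        · intro i _ hij
          rcases lt_or_gt_of_ne hij with h | h
          · -- `i < j`: coefficient already known to vanish
            rw [ih i (by rw [← hj]; exact h) i rfl, zero_mul]
          · -- `j < i`: certified zero of the value matrix
            rw [hM0 i j h, mul_zero]
        · intro h; exact absurd (Finset.mem_univ j) h
      rw [← key]
      exact hev j
  simpa using hli.fintype_card_le_finrank

end Summit.MatrixMultiplication.MatrixMultiplication.Theorems.SubgroupIdentityDesigns.Negative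

end
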